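import Literature.Geometry.Kaehler.RiemannSurfaceOnePole
import Mathlib.Analysis.Complex.RemovableSingularity
import Mathlib.Analysis.Analytic.IsolatedZeros
import Mathlib.Geometry.Manifold.MFDeriv.Atlas
import Mathlib.Geometry.Manifold.ContMDiff.Atlas
import HarnessLib

/-!
# Meromorphic functions separating finitely many points of a compact Riemann surface

Layer `Literature/Geometry/Kaehler`, sequel of `RiemannSurfaceOnePole` (O. Forster, *Lectures on
Riemann Surfaces*, GTM 81 (1981), §14 Thm. 14.12: on a compact Riemann surface `M`, for every point
`p` there is a function `f` holomorphic on `M ∖ {p}` with a genuine pole at `p`, from the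
Cartan–Serre finiteness of `H¹(M, 𝒪)`). Here we draw the classical consequence (Forster, §14
Cor. 14.13: *the meromorphic functions on a compact Riemann surface separate points*), in the
elementary form needed by the algebraisation of finite coverings of affine curves:

* `mdifferentiableAt_of_tendsto` — the removable singularity theorem on a Riemann surface (a function
  holomorphic on a punctured neighbourhood of `p` and continuous at `p` is holomorphic at `p`;
  Mathlib's `Complex.differentiableOn_compl_singleton_and_continuousAt_iff` in the chart at `p`);
* `eventually_eq_or_eventually_ne` — isolated zeros on a Riemann surface
  (`AnalyticAt.eventually_eq_zero_or_eventually_ne_zero` in a chart);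
* `norm_inv_sub_le_of_eventually_ne` — at an isolated zero `x₀` of `f - c`,
  `|f - c|⁻¹ ≤ C |z|^{-N}` for the chart coordinate `z` centred at `x₀` (the local factorisation
  `f - c = z^N v`, `v(x₀) ≠ 0`);
* `exists_inv_pole` — **for `p ∈ M` and a finite set `K ∌ p` there is `u = 1/(f - w)` with `f` the
  function of Thm. 14.12 at `p` and `w` off `f(K)`: `u` is holomorphic off a finite set `P` of genuine
  poles (`P` disjoint from `K ∪ {p}`), `u(p) = 0`, `u ≠ 0` on `K`, and `|u| ≤ C |z|^{-N}` at each pole**;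
* `exists_mdifferentiable_injOn` — **separation**: for finite sets `A` and `B` of `M` there is a
  function `g`, holomorphic off a finite set `P` of poles disjoint from `A ∪ B`, injective on `A`, with
  `|g| ≤ C |z|^{-N}` at each pole (induction on `A`: `g + λ u` for `u` as above at the new point and
  `λ` off a finite set of bad values).

Everything is proved.

## References

* O. Forster, *Lectures on Riemann Surfaces*, GTM 81, Springer (1981), §14 Thm. 14.12, Cor. 14.13.
  [Forster1981]
-/

noncomputable section

open scoped Manifold ContDiff Topology
open Set Filter Function Complex

namespace Literature.Geometry.Kaehler

namespace RiemannSurface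

variable {M : Type*} [TopologicalSpace M] [ChartedSpace ℂ M]

/-! ### Charts: punctured neighbourhoods and holomorphy -/

/-- The chart at `x₀` maps punctured neighbourhoods of `x₀` into punctured neighbourhoods of its
image. [folklore] -/
theorem tendsto_chartAt_nhdsNE (x₀ : M) : Tendsto (chartAt ℂ x₀) (𝓝[≠] x₀) (𝓝[≠] (chartAt ℂ x₀ x₀)) := by
  refine tendsto_nhdsWithin_iff.2 ⟨?_, ?_⟩
  · exact ((chartAt ℂ x₀).continuousAt (mem_chart_source ℂ x₀)).mono_left nhdsWithin_le_nhds
  · filter_upwards [eventually_mem_source_diff x₀] with x hx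
    exact fun h ↦ hx.2 ((chartAt ℂ x₀).injOn hx.1 (mem_chart_source ℂ x₀) h)

/-- The inverse chart at `x₀` maps punctured neighbourhoods of the image of `x₀` into punctured
neighbourhoods of `x₀`. [folklore] -/
theorem tendsto_chartAt_symm_nhdsNE (x₀ : M) :
    Tendsto (chartAt ℂ x₀).symm (𝓝[≠] (chartAt ℂ x₀ x₀)) (𝓝[≠] x₀) := by
  refine tendsto_nhdsWithin_iff.2 ⟨?_, ?_⟩
  · have h := ((chartAt ℂ x₀).continuousAt_symm ((chartAt ℂ x₀).map_source (mem_chart_source ℂ x₀))).mono_left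
      (nhdsWithin_le_nhds (s := {chartAt ℂ x₀ x₀}ᶜ))
    rwa [(chartAt ℂ x₀).left_inv (mem_chart_source ℂ x₀)] at h
  · have h1 : ∀ᶠ z in 𝓝[≠] (chartAt ℂ x₀ x₀), z ∈ (chartAt ℂ x₀).target :=
      mem_nhdsWithin_of_mem_nhds ((chartAt ℂ x₀).open_target.mem_nhds ((chartAt ℂ x₀).map_source (mem_chart_source ℂ x₀)))
    have h2 : ∀ᶠ z in 𝓝[≠] (chartAt ℂ x₀ x₀), z ∈ ({chartAt ℂ x₀ x₀}ᶜ : Set ℂ) := self_mem_nhdsWithin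
    filter_upwards [h1, h2] with z hz hz2
    intro h
    apply hz2
    have h' : (chartAt ℂ x₀).symm z = x₀ := h
    have := congr_arg (chartAt ℂ x₀) h'
    rw [(chartAt ℂ x₀).right_inv hz] at this
    exact this

/-- A function agrees near `x₀` with its chart expression composed with the chart. [folklore] -/
theorem eventuallyEq_comp_chartAt (f : M → ℂ) (x₀ : M) : f =ᶠ[𝓝 x₀] (f ∘ (chartAt ℂ x₀).symm) ∘ chartAt ℂ x₀ := by
  filter_upwards [(chartAt ℂ x₀).open_source.mem_nhds (mem_chart_source ℂ x₀)] with x hx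
  simp only [comp_apply, (chartAt ℂ x₀).left_inv hx]

variable [IsManifold 𝓘(ℂ, ℂ) ω M]

/-- **Holomorphy from the chart expression**: if `f ∘ φ⁻¹` is complex differentiable at `φ(x₀)` for the
chart `φ` at `x₀`, then `f` is holomorphic at `x₀`. [folklore] -/
theorem mdifferentiableAt_of_differentiableAt_comp_symm {f : M → ℂ} {x₀ : M}
    (h : DifferentiableAt ℂ (f ∘ (chartAt ℂ x₀).symm) (chartAt ℂ x₀ x₀)) : MDifferentiableAt 𝓘(ℂ, ℂ) 𝓘(ℂ, ℂ) f x₀ :=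
  (h.mdifferentiableAt.comp x₀ (mdifferentiableAt_atlas (I := 𝓘(ℂ, ℂ)) (chart_mem_atlas ℂ x₀) (mem_chart_source ℂ x₀))).congr_of_eventuallyEq
    (eventuallyEq_comp_chartAt f x₀)

/-- **The chart expression of a holomorphic function is complex differentiable**: if `f` is
holomorphic at a point `y` of the domain of the chart `φ` at `x₀`, then `f ∘ φ⁻¹` is differentiable at
`φ(y)`. [folklore] -/
theorem differentiableAt_comp_symm {f : M → ℂ} {x₀ y : M} (hy : y ∈ (chartAt ℂ x₀).source)
    (hf : MDifferentiableAt 𝓘(ℂ, ℂ) 𝓘(ℂ, ℂ) f y) : DifferentiableAt ℂ (f ∘ (chartAt ℂ x₀).symm) (chartAt ℂ x₀ y) := by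
  have h1 : MDifferentiableAt 𝓘(ℂ, ℂ) 𝓘(ℂ, ℂ) (chartAt ℂ x₀).symm (chartAt ℂ x₀ y) :=
    mdifferentiableAt_atlas_symm (I := 𝓘(ℂ, ℂ)) (chart_mem_atlas ℂ x₀) ((chartAt ℂ x₀).map_source hy)
  have hf' : MDifferentiableAt 𝓘(ℂ, ℂ) 𝓘(ℂ, ℂ) f ((chartAt ℂ x₀).symm (chartAt ℂ x₀ y)) := by
    rwa [(chartAt ℂ x₀).left_inv hy]
  exact mdifferentiableAt_iff_differentiableAt.1 (hf'.comp _ h1)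

/-- If `f` is holomorphic near `x₀`, its chart expression is differentiable near `φ(x₀)`. [folklore] -/
theorem eventually_differentiableAt_comp_symm {f : M → ℂ} {x₀ : M}
    (hf : ∀ᶠ y in 𝓝 x₀, MDifferentiableAt 𝓘(ℂ, ℂ) 𝓘(ℂ, ℂ) f y) :
    ∀ᶠ z in 𝓝 (chartAt ℂ x₀ x₀), DifferentiableAt ℂ (f ∘ (chartAt ℂ x₀).symm) z := by
  have hsrc : ∀ᶠ y in 𝓝 x₀, y ∈ (chartAt ℂ x₀).source := (chartAt ℂ x₀).open_source.mem_nhds (mem_chart_source ℂ x₀)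
  have h : ∀ᶠ y in 𝓝 x₀, DifferentiableAt ℂ (f ∘ (chartAt ℂ x₀).symm) (chartAt ℂ x₀ y) := by
    filter_upwards [hf, hsrc] with y hy hy'
    exact differentiableAt_comp_symm hy' hy
  rw [← (chartAt ℂ x₀).map_nhds_eq (mem_chart_source ℂ x₀), eventually_map]
  exact h

/-- If `f` is holomorphic near `x₀`, its chart expression is analytic at `φ(x₀)`. [folklore] -/
theorem analyticAt_comp_symm {f : M → ℂ} {x₀ : M} (hf : ∀ᶠ y in 𝓝 x₀, MDifferentiableAt 𝓘(ℂ, ℂ) 𝓘(ℂ, ℂ) f y) :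
    AnalyticAt ℂ (f ∘ (chartAt ℂ x₀).symm) (chartAt ℂ x₀ x₀) :=
  analyticAt_iff_eventually_differentiableAt.2 (eventually_differentiableAt_comp_symm hf)

/-- If `f` is holomorphic on a punctured neighbourhood of `x₀`, its chart expression is differentiable
on a punctured neighbourhood of `φ(x₀)`. [folklore] -/
theorem eventually_nhdsNE_differentiableAt_comp_symm {f : M → ℂ} {x₀ : M}
    (hf : ∀ᶠ y in 𝓝[≠] x₀, MDifferentiableAt 𝓘(ℂ, ℂ) 𝓘(ℂ, ℂ) f y) :
    ∀ᶠ z in 𝓝[≠] (chartAt ℂ x₀ x₀), DifferentiableAt ℂ (f ∘ (chartAt ℂ x₀).symm) z := by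
  have h1 : ∀ᶠ z in 𝓝[≠] (chartAt ℂ x₀ x₀), z ∈ (chartAt ℂ x₀).target :=
    mem_nhdsWithin_of_mem_nhds ((chartAt ℂ x₀).open_target.mem_nhds ((chartAt ℂ x₀).map_source (mem_chart_source ℂ x₀)))
  filter_upwards [(tendsto_chartAt_symm_nhdsNE x₀).eventually hf, h1] with z hz hzt
  have h := differentiableAt_comp_symm (x₀ := x₀) ((chartAt ℂ x₀).map_target hzt) hz
  rwa [(chartAt ℂ x₀).right_inv hzt] at h

/-! ### Removable singularities and isolated zeros on a Riemann surface -/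

/-- **The removable singularity theorem on a Riemann surface**: a function holomorphic on a punctured
neighbourhood of `p` which tends to its value at `p` is holomorphic at `p`.
[cite: Forster1981, §1 (Riemann's theorem on removable singularities)] -/
theorem mdifferentiableAt_of_tendsto {u : M → ℂ} {p : M} (hd : ∀ᶠ x in 𝓝[≠] p, MDifferentiableAt 𝓘(ℂ, ℂ) 𝓘(ℂ, ℂ) u x)
    (hc : Tendsto u (𝓝[≠] p) (𝓝 (u p))) : MDifferentiableAt 𝓘(ℂ, ℂ) 𝓘(ℂ, ℂ) u p := by
  set φ := chartAt ℂ p with hφ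
  set H : ℂ → ℂ := u ∘ φ.symm with hH
  set z₀ : ℂ := φ p with hz₀
  -- `H` is continuous at `z₀`
  have hcont : ContinuousAt u p := continuousWithinAt_compl_self.1 hc
  have hHc : ContinuousAt H z₀ := by
    have h1 : ContinuousAt φ.symm z₀ := φ.continuousAt_symm (φ.map_source (mem_chart_source ℂ p))
    have h2 : ContinuousAt u (φ.symm z₀) := by rwa [hz₀, φ.left_inv (mem_chart_source ℂ p)]
    exact h2.comp h1
  -- `H` is differentiable on a punctured ball
  obtain ⟨r, hr, hball⟩ : ∃ r > 0, ∀ z ∈ Metric.ball z₀ r \ {z₀}, DifferentiableAt ℂ H z := by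
    have h := eventually_nhdsNE_differentiableAt_comp_symm hd
    rw [eventually_nhdsWithin_iff, Metric.eventually_nhds_iff_ball] at h
    obtain ⟨r, hr, h⟩ := h
    exact ⟨r, hr, fun z hz ↦ h z hz.1 hz.2⟩
  have hHd : DifferentiableOn ℂ H (Metric.ball z₀ r \ {z₀}) := fun z hz ↦ (hball z hz).differentiableWithinAt
  have hHball : DifferentiableOn ℂ H (Metric.ball z₀ r) :=
    (differentiableOn_compl_singleton_and_continuousAt_iff (Metric.ball_mem_nhds z₀ hr)).1 ⟨hHd, hHc⟩
  exact mdifferentiableAt_of_differentiableAt_comp_symm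
    (hHball.differentiableAt (Metric.ball_mem_nhds z₀ hr))

/-- **Isolated zeros on a Riemann surface**: a function holomorphic near `x₀` is either equal to `c`
near `x₀` or different from `c` on a punctured neighbourhood of `x₀`.
[cite: Forster1981, §1 (identity theorem)] -/
theorem eventually_eq_or_eventually_ne {f : M → ℂ} {x₀ : M} (hf : ∀ᶠ y in 𝓝 x₀, MDifferentiableAt 𝓘(ℂ, ℂ) 𝓘(ℂ, ℂ) f y)
    (c : ℂ) : (∀ᶠ y in 𝓝 x₀, f y = c) ∨ (∀ᶠ y in 𝓝[≠] x₀, f y ≠ c) := by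
  have han : AnalyticAt ℂ (fun z ↦ (f ∘ (chartAt ℂ x₀).symm) z - c) (chartAt ℂ x₀ x₀) :=
    (analyticAt_comp_symm hf).sub analyticAt_const
  rcases han.eventually_eq_zero_or_eventually_ne_zero with h | h
  · left
    have h' := ((chartAt ℂ x₀).continuousAt (mem_chart_source ℂ x₀)).eventually h
    filter_upwards [h', (chartAt ℂ x₀).open_source.mem_nhds (mem_chart_source ℂ x₀)] with y hy hy'
    simp only [comp_apply, (chartAt ℂ x₀).left_inv hy'] at hy
    exact sub_eq_zero.1 hy
  · right
    filter_upwards [(tendsto_chartAt_nhdsNE x₀).eventually h, eventually_mem_source_diff x₀] with y hy hy'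
    simp only [comp_apply, (chartAt ℂ x₀).left_inv hy'.1] at hy
    exact sub_ne_zero.1 hy

/-- **Pole order at an isolated zero**: if `f` is holomorphic near `x₀` and `f ≠ c` on a punctured
neighbourhood of `x₀`, then `|f - c|⁻¹ ≤ C |z|^{-N}` near `x₀` for the chart coordinate `z` centred at
`x₀` (local factorisation `f - c = z^N v`, `v(x₀) ≠ 0`). [cite: Forster1981, §1] -/
theorem norm_inv_sub_le_of_eventually_ne {f : M → ℂ} {x₀ : M} (hf : ∀ᶠ y in 𝓝 x₀, MDifferentiableAt 𝓘(ℂ, ℂ) 𝓘(ℂ, ℂ) f y)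
    {c : ℂ} (hne : ∀ᶠ y in 𝓝[≠] x₀, f y ≠ c) :
    ∃ (N : ℕ) (C : ℝ), ∀ᶠ x in 𝓝[≠] x₀, ‖(f x - c)⁻¹‖ ≤ C * ‖coord x₀ x‖⁻¹ ^ N := by
  set φ := chartAt ℂ x₀ with hφ
  set z₀ := φ x₀ with hz₀
  have han : AnalyticAt ℂ (fun z ↦ (f ∘ φ.symm) z - c) z₀ := (analyticAt_comp_symm hf).sub analyticAt_const
  -- `f - c` is not identically zero near `x₀` in the chart
  have hnz : ¬∀ᶠ z in 𝓝 z₀, (f ∘ φ.symm) z - c = 0 := by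
    intro h
    have h' : ∀ᶠ z in 𝓝[≠] z₀, (f ∘ φ.symm) z - c = 0 := eventually_nhdsWithin_of_eventually_nhds h
    have h1 : ∀ᶠ z in 𝓝[≠] z₀, z ∈ φ.target :=
      mem_nhdsWithin_of_mem_nhds (φ.open_target.mem_nhds (φ.map_source (mem_chart_source ℂ x₀)))
    have h2 := (tendsto_chartAt_symm_nhdsNE x₀).eventually hne
    obtain ⟨z, hz, -, hz2⟩ := (h'.and (h1.and h2)).exists
    exact hz2 (sub_eq_zero.1 hz)
  obtain ⟨N, v, hv, hv0, hfac⟩ := han.exists_eventuallyEq_pow_smul_nonzero_iff.2 hnz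
  -- `|v| ≥ |v z₀| / 2` near `z₀`
  have hvpos : 0 < ‖v z₀‖ := norm_pos_iff.2 hv0
  have hvlow : ∀ᶠ z in 𝓝 z₀, ‖v z₀‖ / 2 ≤ ‖v z‖ := by
    have h := hv.continuousAt.norm.eventually_const_lt (half_lt_self hvpos)
    exact h.mono fun z hz ↦ hz.le
  refine ⟨N, 2 / ‖v z₀‖, ?_⟩
  have hev := ((φ.continuousAt (mem_chart_source ℂ x₀)).eventually (hfac.and hvlow))
  filter_upwards [mem_nhdsWithin_of_mem_nhds hev, eventually_mem_source_diff x₀] with x hx hx'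
  obtain ⟨hxfac, hxv⟩ := hx
  have hval : (f ∘ φ.symm) (φ x) = f x := by simp only [comp_apply, φ.left_inv hx'.1]
  rw [hval, smul_eq_mul] at hxfac
  have hcoord : φ x - z₀ = coord x₀ x := rfl
  rw [hcoord] at hxfac
  have hc0 : coord x₀ x ≠ 0 := coord_ne_zero hx'.1 hx'.2
  rw [hxfac, mul_inv, norm_mul, norm_inv, norm_pow, norm_inv, inv_pow, mul_comm]
  refine mul_le_mul_of_nonneg_right ?_ (by positivity)
  have hvz : 0 < ‖v (φ x)‖ := lt_of_lt_of_le (half_pos hvpos) hxv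
  rw [inv_le_comm₀ hvz (by positivity), inv_div]
  exact hxv

/-! ### The inverse of a function with one pole -/

section Compact

variable [T2Space M] [CompactSpace M]

/-- **An inverse pole function**: for `p ∈ M` and a finite set `K ∌ p`, with `f` the function of
Forster's Thm. 14.12 (holomorphic off `p`, genuine pole at `p`) and `w ∉ f(K)`, the function
`u = 1/(f - w)` (extended by `0` at `p`) is holomorphic off the finite set `P` of isolated zeros of
`f - w`, `P` is disjoint from `K ∪ {p}`, `u(p) = 0`, `u ≠ 0` on `K`, and `u` has a pole of finite
order at each point of `P`. [cite: Forster1981, §14 Thm. 14.12, Cor. 14.13] -/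
theorem exists_inv_pole (p : M) {K : Set M} (hK : K.Finite) (hpK : p ∉ K) :
    ∃ (u : M → ℂ) (P : Finset M), Disjoint (↑P : Set M) (insert p K) ∧ u p = 0 ∧ (∀ a ∈ K, u a ≠ 0) ∧
      (∀ x ∉ P, MDifferentiableAt 𝓘(ℂ, ℂ) 𝓘(ℂ, ℂ) u x) ∧
      ∀ x₀ ∈ P, ∃ (N : ℕ) (C : ℝ), ∀ᶠ x in 𝓝[≠] x₀, ‖u x‖ ≤ C * ‖coord x₀ x‖⁻¹ ^ N := by
  classical
  obtain ⟨f, m, c, hm, hc, hf, hlim⟩ := exists_pole (M := M) p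
  -- the value `w`, off `f(K)`
  set w : ℂ := (((1 : ℝ) + ∑ a ∈ hK.toFinset, ‖f a‖ : ℝ) : ℂ) with hw
  have hwK : ∀ a ∈ K, f a ≠ w := by
    intro a ha h
    have h1 : ‖f a‖ ≤ ∑ b ∈ hK.toFinset, ‖f b‖ :=
      Finset.single_le_sum (f := fun b ↦ ‖f b‖) (fun _ _ ↦ norm_nonneg _) (hK.mem_toFinset.2 ha)
    have h2 : ‖w‖ = 1 + ∑ b ∈ hK.toFinset, ‖f b‖ := by
      rw [hw, Complex.norm_real, Real.norm_eq_abs, abs_of_nonneg (by positivity)]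
    have h3 : ‖f a‖ = ‖w‖ := by rw [h]
    linarith
  -- holomorphy of `f` off `p`
  have hfat : ∀ x, x ≠ p → MDifferentiableAt 𝓘(ℂ, ℂ) 𝓘(ℂ, ℂ) f x := fun x hx ↦
    (hf x hx).mdifferentiableAt (isOpen_compl_singleton.mem_nhds hx)
  have hfnear : ∀ x, x ≠ p → ∀ᶠ y in 𝓝 x, MDifferentiableAt 𝓘(ℂ, ℂ) 𝓘(ℂ, ℂ) f y := fun x hx ↦
    Filter.Eventually.mono (isOpen_compl_singleton.mem_nhds hx) fun y hy ↦ hfat y hy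
  -- near `p`, `f ≠ w`
  have hbig : ∀ᶠ x in 𝓝[≠] p, ‖w‖ < ‖f x‖ := (tendsto_norm_atTop_of_pole hc hlim hm).eventually_gt_atTop _
  have hnep : ∀ᶠ x in 𝓝[≠] p, f x ≠ w := hbig.mono fun x hx h ↦ by rw [h] at hx; exact lt_irrefl _ hx
  -- the function and its pole set
  set u : M → ℂ := fun x ↦ if x = p then 0 else (f x - w)⁻¹ with hu
  set P₀ : Set M := {x | x ≠ p ∧ f x = w ∧ ¬∀ᶠ y in 𝓝 x, f y = w} with hP₀
  -- `P₀` is finite: it has no accumulation point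
  have hPfin : P₀.Finite := by
    by_contra hinf
    obtain ⟨x, -, hacc⟩ := Set.Infinite.exists_accPt_of_subset_isCompact hinf isCompact_univ (subset_univ _)
    rw [accPt_iff_frequently_nhdsNE] at hacc
    by_cases hxp : x = p
    · subst hxp
      exact (hacc.and_eventually hnep).exists.elim fun y hy ↦ hy.2 hy.1.2.1
    · rcases eventually_eq_or_eventually_ne (hfnear x hxp) w with h | h
      · have h' : ∀ᶠ y in 𝓝[≠] x, ∀ᶠ y' in 𝓝 y, f y' = w := eventually_nhdsWithin_of_eventually_nhds h.eventually_nhds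
        exact (hacc.and_eventually h').exists.elim fun y hy ↦ hy.1.2.2 hy.2
      · exact (hacc.and_eventually h).exists.elim fun y hy ↦ hy.2 hy.1.2.1
  refine ⟨u, hPfin.toFinset, ?_, by simp [hu], ?_, ?_, ?_⟩
  · -- disjointness from `K ∪ {p}`
    rw [Finite.coe_toFinset, Set.disjoint_left]
    rintro x ⟨hxp, hxw, -⟩ hx
    rcases mem_insert_iff.1 hx with rfl | hxK
    · exact hxp rfl
    · exact hwK x hxK hxw
  · -- `u ≠ 0` on `K`
    intro a ha
    have hap : a ≠ p := fun h ↦ hpK (h ▸ ha)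
    simp only [hu, if_neg hap]
    exact inv_ne_zero (sub_ne_zero.2 (hwK a ha))
  · -- holomorphy off `P₀`
    intro x hx
    rw [Finite.mem_toFinset] at hx
    by_cases hxp : x = p
    · subst hxp
      refine mdifferentiableAt_of_tendsto ?_ ?_
      · filter_upwards [hnep, self_mem_nhdsWithin] with y hy hyp
        have hyp' : y ≠ x := hyp
        have heq : u =ᶠ[𝓝 y] fun y' ↦ (f y' - w)⁻¹ := by
          filter_upwards [isOpen_compl_singleton.mem_nhds hyp'] with y' hy'
          exact if_neg hy'
        refine MDifferentiableAt.congr_of_eventuallyEq ?_ heq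
        exact ((differentiableAt_inv (sub_ne_zero.2 hy)).mdifferentiableAt).comp y ((hfat y hyp').sub mdifferentiableAt_const)
      · simp only [hu, if_pos rfl]
        have h1 : Tendsto (fun y ↦ ‖f y - w‖) (𝓝[≠] x) atTop := by
          have h2 : Tendsto (fun y ↦ ‖f y‖ + -‖w‖) (𝓝[≠] x) atTop :=
            tendsto_atTop_add_const_right _ _ (tendsto_norm_atTop_of_pole hc hlim hm)
          refine tendsto_atTop_mono (fun y ↦ ?_) h2
          have := norm_sub_norm_le (f y) w
          have := abs_norm_sub_norm_le (f y) w
          linarith [norm_sub_le (f y - w) (-w), (by rw [sub_neg_eq_add, sub_add_cancel] : f y - w - -w = f y)]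
        have h3 : Tendsto (fun y ↦ (f y - w)⁻¹) (𝓝[≠] x) (𝓝 0) := by
          rw [tendsto_zero_iff_norm_tendsto_zero]
          have h4 := tendsto_inv_atTop_zero.comp h1
          refine h4.congr fun y ↦ ?_
          simp only [comp_apply, norm_inv]
        refine h3.congr' ?_
        filter_upwards [self_mem_nhdsWithin] with y hy
        exact (if_neg hy).symm
    · by_cases hxw : f x = w
      · -- interior zero: `u = 0` near `x`
        have hev : ∀ᶠ y in 𝓝 x, f y = w := by
          by_contra h
          exact hx ⟨hxp, hxw, h⟩
        have heq : u =ᶠ[𝓝 x] fun _ ↦ 0 := by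
          filter_upwards [hev, isOpen_compl_singleton.mem_nhds hxp] with y hy hyp
          have hyp' : y ≠ p := hyp
          simp only [hu, if_neg hyp', hy, sub_self, inv_zero]
        exact mdifferentiableAt_const.congr_of_eventuallyEq heq
      · have heq : u =ᶠ[𝓝 x] fun y ↦ (f y - w)⁻¹ := by
          filter_upwards [isOpen_compl_singleton.mem_nhds hxp] with y hy
          exact if_neg hy
        refine MDifferentiableAt.congr_of_eventuallyEq ?_ heq
        exact ((differentiableAt_inv (sub_ne_zero.2 hxw)).mdifferentiableAt).comp x ((hfat x hxp).sub mdifferentiableAt_const)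
  · -- growth at the poles
    intro x₀ hx₀
    rw [Finite.mem_toFinset] at hx₀
    obtain ⟨hx₀p, hx₀w, hx₀ev⟩ := hx₀
    have hne : ∀ᶠ y in 𝓝[≠] x₀, f y ≠ w := by
      rcases eventually_eq_or_eventually_ne (hfnear x₀ hx₀p) w with h | h
      · exact absurd h hx₀ev
      · exact h
    obtain ⟨N, C, hNC⟩ := norm_inv_sub_le_of_eventually_ne (hfnear x₀ hx₀p) hne
    refine ⟨N, C, ?_⟩
    filter_upwards [hNC, mem_nhdsWithin_of_mem_nhds (isOpen_compl_singleton.mem_nhds hx₀p)] with x hx hxp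
    have hxp' : x ≠ p := hxp
    simp only [hu, if_neg hxp']
    exact hx

/-! ### Separation of finitely many points -/

omit [IsManifold 𝓘(ℂ, ℂ) ω M] [T2Space M] [CompactSpace M] in
/-- Near a point, `1 ≤ |z|^{-N}` for the centred chart coordinate `z`. [folklore] -/
theorem eventually_one_le_norm_coord_inv_pow (x₀ : M) (N : ℕ) : ∀ᶠ x in 𝓝[≠] x₀, (1 : ℝ) ≤ ‖coord x₀ x‖⁻¹ ^ N := by
  have h1 : ∀ᶠ x in 𝓝[≠] x₀, ‖coord x₀ x‖ < 1 :=
    mem_nhdsWithin_of_mem_nhds ((tendsto_coord x₀).norm.eventually_lt_const (by rw [norm_zero]; exact one_pos))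
  filter_upwards [h1, eventually_coord_ne_zero x₀] with x hx hx0
  exact one_le_pow₀ ((one_le_inv₀ (norm_pos_iff.2 hx0)).2 hx.le)

omit [IsManifold 𝓘(ℂ, ℂ) ω M] [T2Space M] [CompactSpace M] in
/-- Adding a function bounded near `x₀` to a function with a pole of finite order keeps a pole of
finite order. [folklore] -/
theorem growth_add {g u : M → ℂ} {x₀ : M} {N : ℕ} {C : ℝ} (hg : ∀ᶠ x in 𝓝[≠] x₀, ‖g x‖ ≤ C * ‖coord x₀ x‖⁻¹ ^ N)
    (hu : ContinuousAt u x₀) (l : ℂ) :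
    ∀ᶠ x in 𝓝[≠] x₀, ‖g x + l * u x‖ ≤ (|C| + ‖l‖ * (‖u x₀‖ + 1)) * ‖coord x₀ x‖⁻¹ ^ N := by
  have hub : ∀ᶠ x in 𝓝[≠] x₀, ‖u x‖ ≤ ‖u x₀‖ + 1 := by
    have h := hu.norm.eventually_lt_const (lt_add_one ‖u x₀‖)
    exact mem_nhdsWithin_of_mem_nhds (h.mono fun x hx ↦ hx.le)
  filter_upwards [hg, hub, eventually_one_le_norm_coord_inv_pow x₀ N] with x hx hxu hone
  have hpow : 0 ≤ ‖coord x₀ x‖⁻¹ ^ N := by positivity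
  have h1 : ‖g x‖ ≤ |C| * ‖coord x₀ x‖⁻¹ ^ N := hx.trans (mul_le_mul_of_nonneg_right (le_abs_self C) hpow)
  have h2 : ‖l‖ * ‖u x‖ ≤ ‖l‖ * (‖u x₀‖ + 1) * ‖coord x₀ x‖⁻¹ ^ N :=
    calc ‖l‖ * ‖u x‖ ≤ ‖l‖ * (‖u x₀‖ + 1) := by gcongr
      _ = ‖l‖ * (‖u x₀‖ + 1) * 1 := (mul_one _).symm
      _ ≤ ‖l‖ * (‖u x₀‖ + 1) * ‖coord x₀ x‖⁻¹ ^ N := by gcongr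
  calc ‖g x + l * u x‖ ≤ ‖g x‖ + ‖l * u x‖ := norm_add_le _ _
    _ = ‖g x‖ + ‖l‖ * ‖u x‖ := by rw [norm_mul]
    _ ≤ |C| * ‖coord x₀ x‖⁻¹ ^ N + ‖l‖ * (‖u x₀‖ + 1) * ‖coord x₀ x‖⁻¹ ^ N := add_le_add h1 h2
    _ = (|C| + ‖l‖ * (‖u x₀‖ + 1)) * ‖coord x₀ x‖⁻¹ ^ N := by ring

/-- **Meromorphic functions separate points** (Forster, Cor. 14.13), quantitative elementary form: for
finite sets `A`, `B` of a compact Riemann surface there is a function `g` holomorphic off a finite set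
`P` of poles disjoint from `A ∪ B`, injective on `A`, with a pole of finite order at each point of `P`
(`|g| ≤ C |z|^{-N}` for the chart coordinate `z` centred there). [cite: Forster1981, §14 Cor. 14.13] -/
theorem exists_mdifferentiable_injOn (A : Finset M) {B : Set M} (hB : B.Finite) :
    ∃ (g : M → ℂ) (P : Finset M), Disjoint (↑P : Set M) (↑A ∪ B) ∧
      (∀ x ∉ P, MDifferentiableAt 𝓘(ℂ, ℂ) 𝓘(ℂ, ℂ) g x) ∧ Set.InjOn g A ∧
      ∀ x₀ ∈ P, ∃ (N : ℕ) (C : ℝ), ∀ᶠ x in 𝓝[≠] x₀, ‖g x‖ ≤ C * ‖coord x₀ x‖⁻¹ ^ N := by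
  classical
  induction A using Finset.induction_on generalizing B with
  | empty =>
    refine ⟨fun _ ↦ 0, ∅, by simp, fun x _ ↦ mdifferentiableAt_const, by simp [Set.InjOn], by simp⟩
  | insert b A₀ hb ih =>
    -- the previous function, with `b` forbidden as a pole
    obtain ⟨g₀, P₀, hP₀, hg₀, hinj₀, hgr₀⟩ := ih (hB.insert b)
    -- the new inverse pole function at `b`, with poles off `A₀ ∪ B ∪ P₀`
    set K : Set M := (↑A₀ ∪ B ∪ ↑P₀) \ {b} with hKdef
    have hK : K.Finite := ((A₀.finite_toSet.union hB).union P₀.finite_toSet).subset Set.sdiff_subset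
    have hbK : b ∉ K := fun h ↦ h.2 rfl
    obtain ⟨u, P₁, hP₁, hub, huK, hu, hgr₁⟩ := exists_inv_pole b hK hbK
    -- facts about membership
    have hA₀K : ∀ a ∈ A₀, a ∈ K := fun a ha ↦ ⟨Or.inl (Or.inl ha), fun h ↦ hb (by rw [mem_singleton_iff.1 h] at ha; exact ha)⟩
    have hP₀b : b ∉ P₀ := fun h ↦ Set.disjoint_left.1 hP₀ h (Or.inr (mem_insert _ _))
    have hP₀K : ∀ x ∈ P₀, x ∈ K := fun x hx ↦ ⟨Or.inr hx, fun h ↦ hP₀b (by rw [mem_singleton_iff.1 h] at hx; exact hx)⟩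
    have hP₁P₀ : ∀ x ∈ P₁, x ∉ P₀ := fun x hx hx' ↦
      Set.disjoint_left.1 hP₁ (Finset.mem_coe.2 hx) (mem_insert_of_mem _ (hP₀K x hx'))
    have hP₀P₁ : ∀ x ∈ P₀, x ∉ P₁ := fun x hx hx' ↦ hP₁P₀ x hx' hx
    have hP₁A₀ : ∀ x ∈ P₁, x ∉ A₀ := fun x hx hx' ↦
      Set.disjoint_left.1 hP₁ (Finset.mem_coe.2 hx) (mem_insert_of_mem _ (hA₀K x hx'))
    have hP₁b : b ∉ P₁ := fun h ↦ Set.disjoint_left.1 hP₁ (Finset.mem_coe.2 h) (mem_insert _ _)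
    have hP₁B : ∀ x ∈ P₁, x ∉ B := by
      intro x hx hxB
      by_cases hxb : x = b
      · exact hP₁b (hxb ▸ hx)
      · exact Set.disjoint_left.1 hP₁ (Finset.mem_coe.2 hx) (mem_insert_of_mem _ ⟨Or.inl (Or.inr hxB), hxb⟩)
    -- the bad multipliers
    set S : Set ℂ := ((fun a ↦ (g₀ b - g₀ a) / u a) '' ↑A₀) ∪
      ((fun q : M × M ↦ (g₀ q.2 - g₀ q.1) / (u q.1 - u q.2)) '' (↑A₀ ×ˢ ↑A₀)) with hS
    have hSfin : S.Finite := (A₀.finite_toSet.image _).union ((A₀.finite_toSet.prod A₀.finite_toSet).image _)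
    obtain ⟨l, hl⟩ := hSfin.infinite_compl.nonempty
    have hl1 : ∀ a ∈ A₀, g₀ a + l * u a ≠ g₀ b := by
      intro a ha h
      apply hl
      refine Or.inl ⟨a, ha, ?_⟩
      have hua : u a ≠ 0 := huK a (hA₀K a ha)
      field_simp
      linear_combination -h
    have hl2 : ∀ a ∈ A₀, ∀ a' ∈ A₀, u a ≠ u a' → g₀ a + l * u a ≠ g₀ a' + l * u a' := by
      intro a ha a' ha' hne h
      apply hl
      refine Or.inr ⟨(a, a'), ⟨ha, ha'⟩, ?_⟩
      have hsub : u a - u a' ≠ 0 := sub_ne_zero.2 hne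
      simp only
      field_simp
      linear_combination -h
    -- the new function
    refine ⟨fun x ↦ g₀ x + l * u x, P₀ ∪ P₁, ?_, ?_, ?_, ?_⟩
    · -- disjointness
      rw [Finset.coe_union, Finset.coe_insert, Set.disjoint_left]
      rintro x (hx | hx) hx'
      · exact Set.disjoint_left.1 hP₀ hx (by
          rcases hx' with hx' | hx'
          · rcases mem_insert_iff.1 hx' with rfl | h
            · exact Or.inr (mem_insert _ _)
            · exact Or.inl h
          · exact Or.inr (mem_insert_of_mem _ hx'))
      · rcases hx' with hx' | hx'
        · rcases mem_insert_iff.1 hx' with rfl | h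
          · exact hP₁b hx
          · exact hP₁A₀ x hx h
        · exact hP₁B x hx hx'
    · -- holomorphy off the poles
      intro x hx
      rw [Finset.mem_union, not_or] at hx
      exact (hg₀ x hx.1).add (mdifferentiableAt_const.mul (hu x hx.2))
    · -- injectivity on `insert b A₀`
      rw [Finset.coe_insert]
      intro x hx y hy hxy
      simp only at hxy
      rcases mem_insert_iff.1 hx with rfl | hxA <;> rcases mem_insert_iff.1 hy with rfl | hyA
      · rfl
      · rw [hub, mul_zero, add_zero] at hxy
        exact absurd hxy.symm (hl1 y hyA)
      · rw [hub, mul_zero, add_zero] at hxy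
        exact absurd hxy (hl1 x hxA)
      · by_cases hu' : u x = u y
        · rw [hu', add_left_inj] at hxy
          exact hinj₀ hxA hyA hxy
        · exact absurd hxy (hl2 x hxA y hyA hu')
    · -- growth at the poles
      intro x₀ hx₀
      rcases Finset.mem_union.1 hx₀ with hx₀ | hx₀
      · obtain ⟨N, C, hNC⟩ := hgr₀ x₀ hx₀
        exact ⟨N, _, growth_add hNC (hu x₀ (hP₀P₁ x₀ hx₀)).continuousAt l⟩
      · obtain ⟨N, C, hNC⟩ := hgr₁ x₀ hx₀
        have hNC' : ∀ᶠ x in 𝓝[≠] x₀, ‖l * u x‖ ≤ ‖l‖ * C * ‖coord x₀ x‖⁻¹ ^ N := by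
          filter_upwards [hNC] with x hx
          rw [norm_mul, mul_assoc]
          exact mul_le_mul_of_nonneg_left hx (norm_nonneg _)
        have h := growth_add hNC' (hg₀ x₀ (hP₁P₀ x₀ hx₀)).continuousAt 1
        refine ⟨N, |‖l‖ * C| + ‖(1 : ℂ)‖ * (‖g₀ x₀‖ + 1), ?_⟩
        filter_upwards [h] with x hx
        show ‖g₀ x + l * u x‖ ≤ _
        rwa [one_mul, add_comm (l * u x)] at hx

end Compact

end RiemannSurface

end Literature.Geometry.Kaehler
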